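import Summits.CriticalPhenomena.CardyFormulaZ2.Theorems.CardySusyWardDiscretisationFamilyExistsLegLocal
import Summits.CriticalPhenomena.CardyFormulaZ2.Theorems.CardySusyWardDiscretisationFamilyExistsColumns
import HarnessLib

/-!
# From geometry to the combinatorial hypotheses of the east leg — helper for `DiscretisationFamilyExists` (stmt-CriticalPhenomena-9644)

Standard position, bare data `⟨Ω, δ, ∅, ∅⟩`.  A deep point `p` (a disc of radius `12δ` about
`p` inside `Ω` whose mesh points all belong to the discrete domain) makes every cell within four
columns and six rows of `p`'s cell an inner face (`isInnerFace_near`); an exterior point `q` in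
`p`'s column with an exterior disc of radius `≥ 4δ` makes the cells of `q`'s row in the columns
`c-3 … c+1` non-inner (`not_isInnerFace_exterior_row`).  Plus floor bookkeeping and the
uniqueness of the first non-clean row of a column (`event_unique`).
-/

noncomputable section

open Set Metric Complex
open Literature.Probability.LatticeModels Literature.Probability.Percolation
  Literature.Probability.LatticeModels.Mesh Literature.Probability.LatticeModels.DiscreteDobrushin

namespace Summit.CriticalPhenomena.CardyFormulaZ2.Theorems.DiscretisationFamilyExists

/-- Floor bookkeeping: `δ ⌊x/δ⌋ ≤ x < δ (⌊x/δ⌋ + 1)`. [folklore] -/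
theorem floor_mesh_bounds {δ : ℝ} (hδ : 0 < δ) (x : ℝ) :
    δ * (⌊x / δ⌋ : ℤ) ≤ x ∧ x < δ * ((⌊x / δ⌋ : ℤ) + 1) := by
  constructor
  · have := mul_le_mul_of_nonneg_left (Int.floor_le (x / δ)) hδ.le
    rwa [mul_div_cancel₀ _ hδ.ne'] at this
  · have := mul_lt_mul_of_pos_left (Int.lt_floor_add_one (x / δ)) hδ
    rwa [mul_div_cancel₀ _ hδ.ne'] at this

/-- **An inner face from two opposite corners in the discrete domain and a disc in `Ω`.**
[folklore] -/
theorem isInnerFace_of_ball_subset {Ω : Set ℂ} {δ : ℝ} (hδ : 0 < δ) {k j : ℤ}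
    (h1 : (![k, j] : Site 2) ∈ meshDomain Ω δ) (h2 : (![k + 1, j + 1] : Site 2) ∈ meshDomain Ω δ)
    (hball : ball (meshPoint δ ![k + 1, j + 1]) (Real.sqrt 2 * δ) ⊆ Ω) :
    (⟨Ω, δ, ∅, ∅⟩ : DiscreteDobrushin).IsInnerFace ![k, j] :=
  isInnerFace_of_corner_ball (E := ⟨Ω, δ, ∅, ∅⟩) hδ (p := ![k, j]) (q := ![k + 1, j + 1])
    (isCorner_vec_iff.2 (Or.inl rfl)) (isCorner_vec_iff.2 (Or.inr (Or.inr (Or.inr rfl))))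
    (by intro i; fin_cases i <;> simp) h1 h2 hball

/-- **The deep block**: cells within four columns and the rows `R-5 … R+1` of the cell `(c, R)`
of a deep point `p` are inner faces. [folklore] -/
theorem isInnerFace_near {Ω : Set ℂ} {δ : ℝ} (hδ : 0 < δ) {p : ℂ} {c R : ℤ}
    (hc : δ * c ≤ p.re ∧ p.re < δ * (c + 1)) (hR : δ * R ≤ p.im ∧ p.im < δ * (R + 1))
    (hpΩ : ball p (12 * δ) ⊆ Ω)
    (hbulk : ∀ x : Site 2, meshPoint δ x ∈ closedBall p (12 * δ) → x ∈ meshDomain Ω δ)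
    {k j : ℤ} (hk : c - 4 ≤ k ∧ k ≤ c + 4) (hj : R - 5 ≤ j ∧ j ≤ R + 1) :
    (⟨Ω, δ, ∅, ∅⟩ : DiscreteDobrushin).IsInnerFace ![k, j] := by
  have hk1 : (c : ℝ) - 4 ≤ k := by exact_mod_cast hk.1
  have hk2 : (k : ℝ) ≤ c + 4 := by exact_mod_cast hk.2
  have hj1 : (R : ℝ) - 5 ≤ j := by exact_mod_cast hj.1
  have hj2 : (j : ℝ) ≤ R + 1 := by exact_mod_cast hj.2
  have hcorner : dist (meshPoint δ ![k + 1, j + 1]) p ≤ 10 * δ := by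
    rw [meshPoint_vec']
    refine (dist_le_of_abs_le (a := 5 * δ) (b := 5 * δ) (abs_le.2 ⟨?_, ?_⟩) (abs_le.2 ⟨?_, ?_⟩)).trans (by linarith)
      <;> push_cast <;> nlinarith
  have hcorner' : dist (meshPoint δ ![k, j]) p ≤ 11 * δ := by
    rw [meshPoint_vec']
    refine (dist_le_of_abs_le (a := 5 * δ) (b := 6 * δ) (abs_le.2 ⟨?_, ?_⟩) (abs_le.2 ⟨?_, ?_⟩)).trans (by linarith)
      <;> push_cast <;> nlinarith
  have hsqrt : Real.sqrt 2 < 3 / 2 := by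
    rw [Real.sqrt_lt' (by norm_num)]; norm_num
  refine isInnerFace_of_ball_subset hδ (hbulk _ (mem_closedBall.2 (by linarith)))
    (hbulk _ (mem_closedBall.2 (by linarith))) ((ball_subset_ball' ?_).trans hpΩ)
  nlinarith [dist_nonneg (x := meshPoint δ ![k + 1, j + 1]) (y := p)]

/-- **The exterior row**: with an exterior point `q` in column `c` (an exterior disc of radius
`≥ 4δ` about it), the cells of `q`'s row in columns `c-3 … c+1` are not inner faces (regular
`Ω`). [folklore] -/
theorem not_isInnerFace_exterior_row {Ω : Set ℂ} {δ : ℝ} (hΩ : IsOpen Ω)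
    (hJE : frontier Ω ⊆ closure (closure Ω)ᶜ) (hext : IsConnected (closure Ω)ᶜ)
    (hunb : ¬ Bornology.IsBounded (closure Ω)ᶜ) (hδ : 0 < δ) {q : ℂ} {c j₁ : ℤ} {r : ℝ}
    (hc : δ * c ≤ q.re ∧ q.re < δ * (c + 1)) (hj₁ : δ * j₁ ≤ q.im ∧ q.im < δ * (j₁ + 1))
    (hq : ball q r ⊆ (closure Ω)ᶜ) (hr : 4 * δ ≤ r) {k : ℤ} (hk : c - 3 ≤ k ∧ k ≤ c + 1) :
    ¬ (⟨Ω, δ, ∅, ∅⟩ : DiscreteDobrushin).IsInnerFace ![k, j₁] := by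
  intro hinner
  have hsub := closure_cell_subset_of_isInnerFace (E := ⟨Ω, δ, ∅, ∅⟩) hΩ hJE hext hunb hδ hinner
  simp only [Matrix.cons_val_zero, Matrix.cons_val_one] at hsub
  -- the witness point of the closed cell near `q`
  set x : ℝ := max (δ * k) (min q.re (δ * (k + 1))) with hx
  have hk1 : (c : ℝ) - 3 ≤ k := by exact_mod_cast hk.1
  have hk2 : (k : ℝ) ≤ c + 1 := by exact_mod_cast hk.2
  have hx1 : δ * k ≤ x := le_max_left _ _
  have hx2 : x ≤ δ * (k + 1) := max_le (by nlinarith) (min_le_right _ _)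
  have hxq : |x - q.re| ≤ 3 * δ := by
    rw [abs_le]; constructor
    · rw [hx]
      rcases le_total q.re (δ * (k + 1)) with h | h
      · rw [min_eq_left h]; have := le_max_right (δ * k) q.re; linarith
      · rw [min_eq_right h]; have := le_max_right (δ * k) (δ * (k + 1)); nlinarith
    · rw [hx]
      refine sub_le_iff_le_add.2 (max_le (by nlinarith) ((min_le_left _ _).trans (by linarith)))
  have hzcl : (⟨x, q.im⟩ : ℂ) ∈ closure (cell δ k j₁) := by
    rw [closure_cell hδ, mem_reProdIm]
    exact ⟨⟨hx1, hx2⟩, hj₁.1, hj₁.2.le⟩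
  have hzq : (⟨x, q.im⟩ : ℂ) ∈ ball q r := by
    rw [mem_ball, Complex.dist_eq]
    refine (norm_le_abs_re_add_abs_im _).trans_lt ?_
    simp only [sub_re, sub_im, sub_self, abs_zero, add_zero]
    linarith
  exact hq hzq (hsub hzcl)

/-- **The first non-clean row of a column is unique.** [folklore] -/
theorem event_unique {C : ℤ → Prop} {R e e' : ℤ} (he : e ≤ R) (he' : e' ≤ R)
    (h1 : ∀ j, e < j → j ≤ R → C j) (h1' : ¬ C e) (h2 : ∀ j, e' < j → j ≤ R → C j) (h2' : ¬ C e') :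
    e = e' := by
  rcases lt_trichotomy e e' with h | h | h
  · exact absurd (h1 e' h he') h2'
  · exact h
  · exact absurd (h2 e h he) h1'

end Summit.CriticalPhenomena.CardyFormulaZ2.Theorems.DiscretisationFamilyExists

end
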